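import Mathlib
import Summits.ValiantsHypothesis.ValiantsHypothesis.Theorems.GeneratorObstructionsGenPrinciple
import Summits.ValiantsHypothesis.ValiantsHypothesis.Theorems.GeneratorObstructionsGenInheritanceUpper
import Literature.Barriers.ValiantsHypothesis.GCTMatrixPoweringScope

/-!
# Route GeneratorObstructions — crux `GenFlipThesis` (stmt-ValiantsHypothesis-11653), line
# `slice-overflow`: the SLICE TRANSFER engine and the monotonicity of slice generator types

Helper file (`--supports stmt-ValiantsHypothesis-11653`) for the registered line
`Cruxes/GenFlipThesis/Lines/slice_overflow.lean`, whose load-bearing stub is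

  `stub_sliceGen`: for every `c` there is `c₀` such that for `1 ≤ m`, `n = m + e ≤ 2^((log₂ m + c)^c)`,
  every final-segment embedding `ι : MatIdx m → MatIdx n` and every weight `χ` of `GL_{m²}`,
  `γ_{ext_ι χ}(tr X_n^m) ≠ 0 → -|χ| ≤ m · 2^((log₂ m + c₀)^c₀)`,

`γ_ψ(f) = dim HWV_ψ(ℂ[Δ_m f]) ⧸ (HWV_ψ ∩ Σ_{ψ₁+ψ₂=ψ, ψᵢ≠0} HWV_ψ₁ · HWV_ψ₂)` the number of minimal
generators of type `ψ` of the algebra of highest-weight vectors of the coordinate ring of the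
orbit closure (`ext_ι χ` = `Function.extend ι χ 0`).  This file proves, sorry-free:

* **transfer engine** (`finrank_ne_zero_of_mem_orbitClosure`,
  `finrank_ne_zero_extend_of_rename_mem_orbitClosure`): if an `m`-form `g₀` in the letters `σ`,
  placed on a final segment `ι(σ) ⊆ τ`, degenerates from `f` (`rename ι g₀ ∈ Δ(f)`), then every
  generator type `χ` of `A(Δ g₀)` gives the generator type `ext_ι χ` of `A(Δ f)` — the landed
  inheritance theorem (`GenInheritance.finrank_ne_zero_rename_of_strictMono`, BLMW 2011 §5.4)
  composed with the landed generator-obstruction principle (`genPrinciple_proof`);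
* **membership facts**: `tr X_n^m` renamed along ANY map of letters has a power-trace
  representation of size `n` (`hasPowTraceRepr_rename_powFormLex`), hence lies in
  `Δ(tr X_{n'}^m)` for `n ≤ n'` (`rename_powFormLex_mem_orbitClosure`, GIP17 Prop. 5 via the
  tree's `mem_orbitClosure_powFormLex_of_hasPowTraceRepr`); `tr X_n^m` is a nonzero form of
  degree `m` (`powFormLex_isHomogeneous`, `powFormLex_ne_zero`);
* **final segments are unique** (`strictMono_eq_of_isUpperSet`);
* **monotonicity in the matrix size** (`powFormLex_genType_mono`, `sliceGenType_mono`): generator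
  types of `A(Δ(tr X_n^m))` inherit to `A(Δ(tr X_{n'}^m))` for `n ≤ n'`, slice types to slice
  types — so inside the window only the TOP size matters (`sliceGen_of_top`);
* **`K2 ⇒ stub_sliceGen`** (`sliceGen_of_powGenDegreeQP`): the line's stub is the route's crux
  `PowGenDegreeQP` (stmt-11655) restricted to final-segment weights (`size_extend`).

Honest framing: bookkeeping around two landed theorems; `stub_sliceGen`, `PowGenDegreeQP`,
`PerGenDegreeSuperQP` and `GenFlipThesis` stay OPEN, and nothing here bears on `VP ≠ VNP`.

References: Bürgisser–Landsberg–Manivel–Weyman, SIAM J. Comput. 40 (2011) §5.4 (inheritance);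
Gesmundo–Ikenmeyer–Panova, Diff. Geom. Appl. 55 (2017) §2.2, Prop. 5 (power-trace model);
Derksen–Makam, Adv. Math. 2020, Lemma 1.3 (surjections preserve generating sets).
-/

namespace Summit.ValiantsHypothesis.ValiantsHypothesis.Theorems.GeneratorObstructions.SliceTransfer

open MvPolynomial
open Literature.NumberTheory.DiophantineGeometry Literature.Computability.AlgebraicComplexity
  Literature.Barriers.ValiantsHypothesis
open Summit.ValiantsHypothesis.ValiantsHypothesis.Theses.GeneratorObstructions
open Summit.ValiantsHypothesis.ValiantsHypothesis.Theorems.GenInheritance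
open Summit.ValiantsHypothesis.ValiantsHypothesis.Theorems.GeneratorObstructionsGenPrinciple

-- `Summit.ValiantsHypothesis.ValiantsHypothesis.…` is the tree's mandated single-conjunct layout.
set_option linter.dupNamespace false

noncomputable section

/-! ## 1. The transfer engine -/

section Engine

variable {σ τ : Type} [Fintype σ] [LinearOrder σ] [Fintype τ] [LinearOrder τ]

/-- **Generator types go UP along degenerations** (corollary of the landed `GenPrinciple`,
`γ_χ(g) ≤ γ_χ(f)` for `g ∈ Δ(f)`): a generator type of `A(Δ g)` is a generator type of `A(Δ f)`.
Derksen–Makam 2020 Lemma 1.3 (surjections preserve generating sets). [folklore] -/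
theorem finrank_ne_zero_of_mem_orbitClosure {f g : MvPolynomial σ ℂ} {m : ℕ} (hm : m ≠ 0)
    (hg : g ∈ orbitClosure f) (χ : Weight σ)
    (h : Module.finrank ℂ (↥(highestWeightSpace (orbitCoordRep g m) χ) ⧸
      Submodule.comap (highestWeightSpace (orbitCoordRep g m) χ).subtype
        (⨆ p : Weight σ × Weight σ, ⨆ (_ : p.1 + p.2 = χ ∧ p.1 ≠ 0 ∧ p.2 ≠ 0),
          highestWeightSpace (orbitCoordRep g m) p.1 * highestWeightSpace (orbitCoordRep g m) p.2)) ≠ 0) :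
    Module.finrank ℂ (↥(highestWeightSpace (orbitCoordRep f m) χ) ⧸
      Submodule.comap (highestWeightSpace (orbitCoordRep f m) χ).subtype
        (⨆ p : Weight σ × Weight σ, ⨆ (_ : p.1 + p.2 = χ ∧ p.1 ≠ 0 ∧ p.2 ≠ 0),
          highestWeightSpace (orbitCoordRep f m) p.1 * highestWeightSpace (orbitCoordRep f m) p.2)) ≠ 0 :=
  fun h0 => h (Nat.eq_zero_of_le_zero (h0 ▸ genPrinciple_proof f g m hm hg χ))

/-- **Slice transfer engine.** For `ι : σ → τ` strictly monotone onto an upper set (a final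
segment of letters), a nonzero form `g₀` of degree `m ≠ 0` in the letters `σ` with
`rename ι g₀ ∈ Δ(f)`, and a generator type `χ` of `A(Δ g₀)`: the weight `χ` extended by zero along
`ι` is a generator type of `A(Δ f)`.  Inheritance (BLMW 2011 §5.4, landed as
`finrank_ne_zero_rename_of_strictMono`) followed by `finrank_ne_zero_of_mem_orbitClosure`.
[folklore] -/
theorem finrank_ne_zero_extend_of_rename_mem_orbitClosure {ι : σ → τ} (hι : StrictMono ι)
    (hup : IsUpperSet (Set.range ι)) {g₀ : MvPolynomial σ ℂ} {f : MvPolynomial τ ℂ} {m : ℕ}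
    (hg₀ : g₀.IsHomogeneous m) (hg₀0 : g₀ ≠ 0) (hm : m ≠ 0)
    (hmem : rename ι g₀ ∈ orbitClosure f) (χ : Weight σ)
    (h : Module.finrank ℂ (↥(highestWeightSpace (orbitCoordRep g₀ m) χ) ⧸
      Submodule.comap (highestWeightSpace (orbitCoordRep g₀ m) χ).subtype
        (⨆ p : Weight σ × Weight σ, ⨆ (_ : p.1 + p.2 = χ ∧ p.1 ≠ 0 ∧ p.2 ≠ 0),
          highestWeightSpace (orbitCoordRep g₀ m) p.1 * highestWeightSpace (orbitCoordRep g₀ m) p.2)) ≠ 0) :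
    Module.finrank ℂ (↥(highestWeightSpace (orbitCoordRep f m) (Function.extend ι χ 0)) ⧸
      Submodule.comap (highestWeightSpace (orbitCoordRep f m) (Function.extend ι χ 0)).subtype
        (⨆ p : Weight τ × Weight τ, ⨆ (_ : p.1 + p.2 = Function.extend ι χ 0 ∧ p.1 ≠ 0 ∧ p.2 ≠ 0),
          highestWeightSpace (orbitCoordRep f m) p.1 * highestWeightSpace (orbitCoordRep f m) p.2)) ≠ 0 :=
  finrank_ne_zero_of_mem_orbitClosure hm hmem _
    (finrank_ne_zero_rename_of_strictMono hι hup hg₀ hg₀0 hm χ h)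

omit [Fintype σ] [Fintype τ] in
/-- **Final segments are unique**: two strictly monotone maps of a finite linear order onto upper
sets of a linear order coincide (upper sets are nested, `IsUpperSet.total`; equal finite
cardinality; `StrictMono.range_inj`). [folklore] -/
theorem strictMono_eq_of_isUpperSet [Finite σ] {ι ι' : σ → τ} (hι : StrictMono ι)
    (hup : IsUpperSet (Set.range ι)) (hι' : StrictMono ι') (hup' : IsUpperSet (Set.range ι')) :
    ι = ι' := by
  have hc : (Set.range ι).ncard = (Set.range ι').ncard := by
    rw [Set.ncard_range_of_injective hι.injective, Set.ncard_range_of_injective hι'.injective]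
  have hfin : (Set.range ι).Finite := Set.finite_range ι
  have hfin' : (Set.range ι').Finite := Set.finite_range ι'
  have heq : Set.range ι = Set.range ι' := by
    rcases hup.total hup' with h | h
    · exact Set.eq_of_subset_of_ncard_le h hc.ge hfin'
    · exact (Set.eq_of_subset_of_ncard_le h hc.le hfin).symm
  exact (hι.range_inj hι').1 heq

omit [Fintype σ] [LinearOrder σ] [Fintype τ] [LinearOrder τ] in
/-- Extension by zero along a composite of injections is the iterated extension by zero.
[folklore] -/
theorem extend_comp_eq_extend_extend {υ : Type} {ι : σ → τ} {κ : τ → υ}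
    (hι : Function.Injective ι) (hκ : Function.Injective κ) (χ : Weight σ) :
    Function.extend (κ ∘ ι) χ (0 : υ → ℤ) = Function.extend κ (Function.extend ι χ 0) 0 := by
  rw [hι.extend_comp hκ]
  rfl

end Engine

/-! ## 2. The power trace: homogeneity, non-vanishing, power-trace representations, membership -/

section PowerTrace

/-- Entries of powers of the generic matrix are forms: `(X^l)_{ij}` is homogeneous of degree `l`.
[folklore] -/
theorem mvPolynomialX_pow_apply_isHomogeneous {k : Type*} [CommRing k] (n l : ℕ) (i j : Fin n) :
    ((Matrix.mvPolynomialX (Fin n) (Fin n) k ^ l) i j).IsHomogeneous l := by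
  induction l generalizing i j with
  | zero =>
    rw [pow_zero, Matrix.one_apply]
    split_ifs
    · exact isHomogeneous_one _ _
    · exact isHomogeneous_zero _ _ _
  | succ l ih =>
    rw [pow_succ, Matrix.mul_apply]
    exact IsHomogeneous.sum _ _ _ fun c _ => by
      simpa using (ih i c).mul (isHomogeneous_X k (c, j))

/-- **`tr X_n^m` is a form of degree `m`** (in the lexicographic matrix letters `MatIdx n`).
Gesmundo–Ikenmeyer–Panova 2017 §2.2. [folklore] -/
theorem powFormLex_isHomogeneous (k : Type*) [Field k] (n m : ℕ) :
    (powFormLex k n m).IsHomogeneous m := by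
  unfold powFormLex powTrace Matrix.trace
  exact (IsHomogeneous.sum _ _ _ fun i _ => by
    simpa using mvPolynomialX_pow_apply_isHomogeneous (k := k) n m i i).rename_isHomogeneous

/-- **`tr X_n^m ≠ 0` for `1 ≤ n`**: at the identity matrix it evaluates to `n`. [folklore] -/
theorem powFormLex_ne_zero {n : ℕ} (hn : 1 ≤ n) (m : ℕ) : powFormLex ℂ n m ≠ 0 := by
  classical
  intro h0
  set φ : MvPolynomial (MatIdx n) ℂ →ₐ[ℂ] ℂ :=
    aeval fun v : MatIdx n => if (ofLex v).1 = (ofLex v).2 then (1 : ℂ) else 0 with hφ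
  have hX : (φ.comp (rename toLex)).mapMatrix (Matrix.mvPolynomialX (Fin n) (Fin n) ℂ) = 1 := by
    refine Matrix.ext fun a b => ?_
    rw [AlgHom.mapMatrix_apply, Matrix.map_apply, Matrix.mvPolynomialX_apply, AlgHom.comp_apply,
      rename_X, hφ, aeval_X, Matrix.one_apply]
    simp
  have h1 : φ (powFormLex ℂ n m) = n := by
    change (φ.comp (rename toLex)) (powTrace ℂ n m) = n
    rw [powTrace, algHom_trace_pow, hX, one_pow, Matrix.trace_one, Fintype.card_fin]
  rw [h0, map_zero] at h1
  have : (n : ℂ) ≠ 0 := Nat.cast_ne_zero.mpr (by omega)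
  exact this h1.symm

/-- **`tr X_n^m` renamed along any map of letters is a power trace of size `n`**: with
`A_{ij} = X_{κ(i,j)}`, `tr(A^m) = κ(tr X_n^m)`. Gesmundo–Ikenmeyer–Panova 2017 §2.2 (definition
of `pc`). [folklore] -/
theorem hasPowTraceRepr_rename_powFormLex {τ : Type*} (n m : ℕ) (κ : MatIdx n → τ) :
    HasPowTraceRepr ℂ (rename κ (powFormLex ℂ n m)) m n := by
  refine ⟨Matrix.of fun i j => X (κ (toLex (i, j))), fun i j => ?_, ?_⟩
  · rw [Matrix.of_apply]; exact isHomogeneous_X ℂ _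
  set ψ : MvPolynomial (Fin n × Fin n) ℂ →ₐ[ℂ] MvPolynomial τ ℂ :=
    (rename κ).comp (rename toLex) with hψ
  have hψX : ψ.mapMatrix (Matrix.mvPolynomialX (Fin n) (Fin n) ℂ) =
      Matrix.of fun i j => X (κ (toLex (i, j))) := by
    refine Matrix.ext fun a b => ?_
    rw [AlgHom.mapMatrix_apply, Matrix.map_apply, Matrix.mvPolynomialX_apply, hψ, AlgHom.comp_apply,
      rename_X, rename_X, Matrix.of_apply]
  calc ((Matrix.of fun i j => X (κ (toLex (i, j))) : Matrix (Fin n) (Fin n) (MvPolynomial τ ℂ)) ^ m).trace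
      = (ψ.mapMatrix (Matrix.mvPolynomialX (Fin n) (Fin n) ℂ) ^ m).trace := by rw [hψX]
    _ = ψ (powTrace ℂ n m) := by rw [powTrace, algHom_trace_pow]
    _ = rename κ (powFormLex ℂ n m) := rfl

/-- **`κ(tr X_n^m) ∈ Δ(tr X_{n'}^m)` for `n ≤ n'` and `1 ≤ m`**, for ANY placement `κ` of the `n²`
letters among the `n'²` letters: pad the size-`n` power-trace representation by zeros
(`HasPowTraceRepr.of_le`) and apply GIP17 Prop. 5 (`mem_orbitClosure_powFormLex_of_hasPowTraceRepr`:
`End · f ⊆ Δ(f)`; Gesmundo–Ikenmeyer–Panova 2017, Prop. 5). [folklore] -/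
theorem rename_powFormLex_mem_orbitClosure {n n' m : ℕ} (hm : 1 ≤ m) (hn : n ≤ n')
    (κ : MatIdx n → MatIdx n') :
    rename κ (powFormLex ℂ n m) ∈ orbitClosure (powFormLex ℂ n' m) :=
  mem_orbitClosure_powFormLex_of_hasPowTraceRepr
    (HasPowTraceRepr.of_le hm hn (hasPowTraceRepr_rename_powFormLex n m κ))

end PowerTrace

/-! ## 3. Monotonicity of (slice) generator types in the matrix size -/

section Mono

/-- A final-segment embedding `MatIdx n → MatIdx n'` exists for `n ≤ n'`. [folklore] -/
theorem exists_finalSegment {n n' : ℕ} (hn : n ≤ n') :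
    ∃ κ : MatIdx n → MatIdx n', StrictMono κ ∧ IsUpperSet (Set.range κ) := by
  have hinj : Function.Injective fun x : MatIdx n =>
      (toLex (Fin.castLE hn (ofLex x).1, Fin.castLE hn (ofLex x).2) : MatIdx n') := by
    intro x y hxy
    have h1 := toLex.injective hxy
    rw [Prod.mk.injEq] at h1
    exact ofLex.injective (Prod.ext (Fin.castLE_injective hn h1.1) (Fin.castLE_injective hn h1.2))
  exact exists_strictMono_isUpperSet (Fintype.card_le_of_injective _ hinj)

/-- **Generator types of `A(Δ(tr X_n^m))` inherit upward in `n`**: for `1 ≤ m`, `1 ≤ n ≤ n'` and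
the final-segment embedding `κ : MatIdx n → MatIdx n'`, `γ_χ(tr X_n^m) ≠ 0` implies
`γ_{ext_κ χ}(tr X_{n'}^m) ≠ 0` (same degree, `size_extend`).  Engine applied to
`κ(tr X_n^m) ∈ Δ(tr X_{n'}^m)`. [folklore] -/
theorem powFormLex_genType_mono {m n n' : ℕ} (hm : 1 ≤ m) (hn1 : 1 ≤ n) (hn : n ≤ n')
    {κ : MatIdx n → MatIdx n'} (hκ : StrictMono κ) (hκup : IsUpperSet (Set.range κ))
    (χ : Weight (MatIdx n))
    (h : Module.finrank ℂ (↥(highestWeightSpace (orbitCoordRep (powFormLex ℂ n m) m) χ) ⧸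
      Submodule.comap (highestWeightSpace (orbitCoordRep (powFormLex ℂ n m) m) χ).subtype
        (⨆ p : Weight (MatIdx n) × Weight (MatIdx n), ⨆ (_ : p.1 + p.2 = χ ∧ p.1 ≠ 0 ∧ p.2 ≠ 0),
          highestWeightSpace (orbitCoordRep (powFormLex ℂ n m) m) p.1 *
            highestWeightSpace (orbitCoordRep (powFormLex ℂ n m) m) p.2)) ≠ 0) :
    Module.finrank ℂ (↥(highestWeightSpace (orbitCoordRep (powFormLex ℂ n' m) m) (Function.extend κ χ 0)) ⧸
      Submodule.comap (highestWeightSpace (orbitCoordRep (powFormLex ℂ n' m) m) (Function.extend κ χ 0)).subtype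
        (⨆ p : Weight (MatIdx n') × Weight (MatIdx n'),
          ⨆ (_ : p.1 + p.2 = Function.extend κ χ 0 ∧ p.1 ≠ 0 ∧ p.2 ≠ 0),
          highestWeightSpace (orbitCoordRep (powFormLex ℂ n' m) m) p.1 *
            highestWeightSpace (orbitCoordRep (powFormLex ℂ n' m) m) p.2)) ≠ 0 :=
  finrank_ne_zero_extend_of_rename_mem_orbitClosure hκ hκup (powFormLex_isHomogeneous ℂ n m)
    (powFormLex_ne_zero hn1 m) (by omega) (rename_powFormLex_mem_orbitClosure hm hn κ) χ h

/-- **Slice generator types inherit upward in `n`**: for `1 ≤ m ≤ n ≤ n'`, final segments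
`ι : MatIdx m → MatIdx n`, `ι' : MatIdx m → MatIdx n'` and a weight `χ` of `GL_{m²}`,
`γ_{ext_ι χ}(tr X_n^m) ≠ 0 → γ_{ext_ι' χ}(tr X_{n'}^m) ≠ 0`: compose with the final segment
`κ : MatIdx n → MatIdx n'` (`κ ∘ ι = ι'` by uniqueness of final segments). So the slice
`Δ(tr X_n^m) ∩ Sym^m ℂ^{m²}` only acquires generator types as `n` grows. [folklore] -/
theorem sliceGenType_mono {m n n' : ℕ} (hm : 1 ≤ m) (hmn : m ≤ n) (hn : n ≤ n')
    {ι : MatIdx m → MatIdx n} (hι : StrictMono ι) (hup : IsUpperSet (Set.range ι))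
    {ι' : MatIdx m → MatIdx n'} (hι' : StrictMono ι') (hup' : IsUpperSet (Set.range ι'))
    (χ : Weight (MatIdx m))
    (h : Module.finrank ℂ (↥(highestWeightSpace (orbitCoordRep (powFormLex ℂ n m) m) (Function.extend ι χ 0)) ⧸
      Submodule.comap (highestWeightSpace (orbitCoordRep (powFormLex ℂ n m) m) (Function.extend ι χ 0)).subtype
        (⨆ p : Weight (MatIdx n) × Weight (MatIdx n),
          ⨆ (_ : p.1 + p.2 = Function.extend ι χ 0 ∧ p.1 ≠ 0 ∧ p.2 ≠ 0),
          highestWeightSpace (orbitCoordRep (powFormLex ℂ n m) m) p.1 *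
            highestWeightSpace (orbitCoordRep (powFormLex ℂ n m) m) p.2)) ≠ 0) :
    Module.finrank ℂ (↥(highestWeightSpace (orbitCoordRep (powFormLex ℂ n' m) m) (Function.extend ι' χ 0)) ⧸
      Submodule.comap (highestWeightSpace (orbitCoordRep (powFormLex ℂ n' m) m) (Function.extend ι' χ 0)).subtype
        (⨆ p : Weight (MatIdx n') × Weight (MatIdx n'),
          ⨆ (_ : p.1 + p.2 = Function.extend ι' χ 0 ∧ p.1 ≠ 0 ∧ p.2 ≠ 0),
          highestWeightSpace (orbitCoordRep (powFormLex ℂ n' m) m) p.1 *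
            highestWeightSpace (orbitCoordRep (powFormLex ℂ n' m) m) p.2)) ≠ 0 := by
  obtain ⟨κ, hκ, hκup⟩ := exists_finalSegment hn
  have hcomp : κ ∘ ι = ι' :=
    strictMono_eq_of_isUpperSet (hκ.comp hι) (by
      rintro x y hxy ⟨a, rfl⟩
      obtain ⟨b, hb⟩ := hκup hxy ⟨ι a, rfl⟩
      have hle : ι a ≤ b := by
        rw [← hκ.le_iff_le, hb]; exact hxy
      obtain ⟨c, hc⟩ := hup hle ⟨a, rfl⟩
      exact ⟨c, by simp [Function.comp_apply, hc, hb]⟩) hι' hup'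
  rw [← hcomp, extend_comp_eq_extend_extend hι.injective hκ.injective]
  exact powFormLex_genType_mono hm (le_trans hm hmn) hn hκ hκup _ h

end Mono

/-! ## 4. Consequences for the stub: top-size reduction and `K2 ⇒ stub_sliceGen` -/

section Stub

/-- **Only the top of the window matters.** If the slice generator types at the TOP matrix size
`n = 2^((log₂ m + c)^c)` of the window have quasi-polynomial degree, then so do those at every size
of the window (`sliceGenType_mono`): the conclusion is the registered `stub_sliceGen` verbatim.
[folklore] -/
theorem sliceGen_of_top
    (htop : ∀ c : ℕ, ∃ c₀ : ℕ, ∀ m e : ℕ, 1 ≤ m → m + e = 2 ^ ((Nat.log 2 m + c) ^ c) →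
      ∀ ι : MatIdx m → MatIdx (m + e), StrictMono ι → IsUpperSet (Set.range ι) →
        ∀ χ : Weight (MatIdx m),
          Module.finrank ℂ (↥(highestWeightSpace (orbitCoordRep (powFormLex ℂ (m + e) m) m) (Function.extend ι χ 0)) ⧸ Submodule.comap (highestWeightSpace (orbitCoordRep (powFormLex ℂ (m + e) m) m) (Function.extend ι χ 0)).subtype (⨆ p : Weight (MatIdx (m + e)) × Weight (MatIdx (m + e)), ⨆ (_ : p.1 + p.2 = (Function.extend ι χ 0) ∧ p.1 ≠ 0 ∧ p.2 ≠ 0), highestWeightSpace (orbitCoordRep (powFormLex ℂ (m + e) m) m) p.1 * highestWeightSpace (orbitCoordRep (powFormLex ℂ (m + e) m) m) p.2)) ≠ 0 →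
            -(Weight.size χ) ≤ (m : ℤ) * 2 ^ ((Nat.log 2 m + c₀) ^ c₀)) :
    ∀ c : ℕ, ∃ c₀ : ℕ, ∀ m e : ℕ, 1 ≤ m → m + e ≤ 2 ^ ((Nat.log 2 m + c) ^ c) →
      ∀ ι : MatIdx m → MatIdx (m + e), StrictMono ι → IsUpperSet (Set.range ι) →
        ∀ χ : Weight (MatIdx m),
          Module.finrank ℂ (↥(highestWeightSpace (orbitCoordRep (powFormLex ℂ (m + e) m) m) (Function.extend ι χ 0)) ⧸ Submodule.comap (highestWeightSpace (orbitCoordRep (powFormLex ℂ (m + e) m) m) (Function.extend ι χ 0)).subtype (⨆ p : Weight (MatIdx (m + e)) × Weight (MatIdx (m + e)), ⨆ (_ : p.1 + p.2 = (Function.extend ι χ 0) ∧ p.1 ≠ 0 ∧ p.2 ≠ 0), highestWeightSpace (orbitCoordRep (powFormLex ℂ (m + e) m) m) p.1 * highestWeightSpace (orbitCoordRep (powFormLex ℂ (m + e) m) m) p.2)) ≠ 0 →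
            -(Weight.size χ) ≤ (m : ℤ) * 2 ^ ((Nat.log 2 m + c₀) ^ c₀) := by
  intro c
  obtain ⟨c₀, hc₀⟩ := htop c
  refine ⟨c₀, fun m e hm he ι hι hup χ hγ => ?_⟩
  set N := 2 ^ ((Nat.log 2 m + c) ^ c) with hN
  obtain ⟨ι', hι', hup'⟩ := exists_finalSegment (n := m) (n' := m + (N - m)) (by omega)
  have htop' := hc₀ m (N - m) hm (by omega) ι' hι' hup' χ
  exact htop' (sliceGenType_mono hm (Nat.le_add_right m e) (by omega) hι hup hι' hup' χ hγ)

/-- **`PowGenDegreeQP ⇒ stub_sliceGen`**: the line's stub is the route's crux K2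
(`PowGenDegreeQP`, stmt-ValiantsHypothesis-11655) restricted to the weights extended by zero from
a final segment, whose size is that of `χ` (`size_extend`); the conclusion is the registered
`stub_sliceGen` verbatim.  (The converse is not claimed: K2 also bounds the WIDE generator types,
those with a nonzero entry off the final `m²` letters.) [folklore] -/
theorem sliceGen_of_powGenDegreeQP (hK2 : PowGenDegreeQP) :
    ∀ c : ℕ, ∃ c₀ : ℕ, ∀ m e : ℕ, 1 ≤ m → m + e ≤ 2 ^ ((Nat.log 2 m + c) ^ c) →
      ∀ ι : MatIdx m → MatIdx (m + e), StrictMono ι → IsUpperSet (Set.range ι) →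
        ∀ χ : Weight (MatIdx m),
          Module.finrank ℂ (↥(highestWeightSpace (orbitCoordRep (powFormLex ℂ (m + e) m) m) (Function.extend ι χ 0)) ⧸ Submodule.comap (highestWeightSpace (orbitCoordRep (powFormLex ℂ (m + e) m) m) (Function.extend ι χ 0)).subtype (⨆ p : Weight (MatIdx (m + e)) × Weight (MatIdx (m + e)), ⨆ (_ : p.1 + p.2 = (Function.extend ι χ 0) ∧ p.1 ≠ 0 ∧ p.2 ≠ 0), highestWeightSpace (orbitCoordRep (powFormLex ℂ (m + e) m) m) p.1 * highestWeightSpace (orbitCoordRep (powFormLex ℂ (m + e) m) m) p.2)) ≠ 0 →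
            -(Weight.size χ) ≤ (m : ℤ) * 2 ^ ((Nat.log 2 m + c₀) ^ c₀) := by
  intro c
  obtain ⟨c₀, hc₀⟩ := hK2 c
  refine ⟨c₀, fun m e hm he ι hι _hup χ hγ => ?_⟩
  have hb := hc₀ m e hm he (Function.extend ι χ 0) hγ
  rwa [size_extend hι.injective] at hb

end Stub

/-! ## 5. The stub as a uniform generation bound for all quasi-polynomially easy forms

(Appended 2026-08-27, same seat.)  `stub_sliceGen` is a statement about ONE orbit closure per size,
`Δ(tr X_n^m)`, read at final-segment weights; unfolded through the transfer engine it bounds the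
generator degrees of the covariant algebra of EVERY `m`-form in `m²` variables that has a power-trace
representation of quasi-polynomial size — the Chow instance (`x₁₁⋯x_mm`, `pc ≤ m`) is
`ChowDichotomy.chowGenQP_of_sliceGen`.  This is the menu for a refutation: any explicit family of
qp-easy forms with late minimal generators kills the stub. -/

section EasyForms

/-- Power-trace representations survive renaming of the variables: if `f = tr(A^n)` with `A` an
`s × s` matrix of linear forms, then `κ(f) = tr((κ A)^n)`. Gesmundo–Ikenmeyer–Panova 2017 §2.2.
[folklore] -/
theorem hasPowTraceRepr_rename {σ τ : Type*} {f : MvPolynomial σ ℂ} {n s : ℕ}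
    (h : HasPowTraceRepr ℂ f n s) (κ : σ → τ) : HasPowTraceRepr ℂ (rename κ f) n s := by
  obtain ⟨A, hA1, hAtr⟩ := h
  refine ⟨(rename κ).mapMatrix A, fun i j => ?_, ?_⟩
  · rw [AlgHom.mapMatrix_apply, Matrix.map_apply]
    exact (hA1 i j).rename_isHomogeneous
  · rw [← algHom_trace_pow, hAtr]

/-- **`stub_sliceGen` ⇒ uniform quasi-polynomial generation for all qp-easy forms.** If the slice
generator types of `A(Δ(tr X_n^m))` have quasi-polynomial degree throughout the window (the
registered `stub_sliceGen`, hypothesis verbatim), then for every `c` there is `c₀` such that for every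
nonzero `m`-form `g` in the `m²` lexicographic matrix variables with a power-trace representation
`g = tr(A^m)` of size `m + e ≤ 2^((log₂ m + c)^c)` (i.e. `pc(g)` inside the window), every generator
type `χ` of the covariant algebra `A(Δ g)` has degree `-|χ| ≤ m · 2^((log₂ m + c₀)^c₀)`.  Proof:
place `g` on the final segment `ι` (`hasPowTraceRepr_rename`), so `ι(g) ∈ Δ(tr X_{m+e}^m)`
(GIP17 Prop. 5, `mem_orbitClosure_powFormLex_of_hasPowTraceRepr`), and transfer
(`finrank_ne_zero_extend_of_rename_mem_orbitClosure`). [folklore] -/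
theorem genQP_of_sliceGen_of_hasPowTraceRepr
    (hS : ∀ c : ℕ, ∃ c₀ : ℕ, ∀ m e : ℕ, 1 ≤ m → m + e ≤ 2 ^ ((Nat.log 2 m + c) ^ c) →
      ∀ ι : MatIdx m → MatIdx (m + e), StrictMono ι → IsUpperSet (Set.range ι) →
        ∀ χ : Weight (MatIdx m),
          Module.finrank ℂ (↥(highestWeightSpace (orbitCoordRep (powFormLex ℂ (m + e) m) m) (Function.extend ι χ 0)) ⧸ Submodule.comap (highestWeightSpace (orbitCoordRep (powFormLex ℂ (m + e) m) m) (Function.extend ι χ 0)).subtype (⨆ p : Weight (MatIdx (m + e)) × Weight (MatIdx (m + e)), ⨆ (_ : p.1 + p.2 = (Function.extend ι χ 0) ∧ p.1 ≠ 0 ∧ p.2 ≠ 0), highestWeightSpace (orbitCoordRep (powFormLex ℂ (m + e) m) m) p.1 * highestWeightSpace (orbitCoordRep (powFormLex ℂ (m + e) m) m) p.2)) ≠ 0 →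
            -(Weight.size χ) ≤ (m : ℤ) * 2 ^ ((Nat.log 2 m + c₀) ^ c₀)) :
    ∀ c : ℕ, ∃ c₀ : ℕ, ∀ m e : ℕ, 1 ≤ m → m + e ≤ 2 ^ ((Nat.log 2 m + c) ^ c) →
      ∀ g : MvPolynomial (MatIdx m) ℂ, g.IsHomogeneous m → g ≠ 0 → HasPowTraceRepr ℂ g m (m + e) →
        ∀ χ : Weight (MatIdx m),
          Module.finrank ℂ (↥(highestWeightSpace (orbitCoordRep g m) χ) ⧸ Submodule.comap (highestWeightSpace (orbitCoordRep g m) χ).subtype (⨆ p : Weight (MatIdx m) × Weight (MatIdx m), ⨆ (_ : p.1 + p.2 = χ ∧ p.1 ≠ 0 ∧ p.2 ≠ 0), highestWeightSpace (orbitCoordRep g m) p.1 * highestWeightSpace (orbitCoordRep g m) p.2)) ≠ 0 →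
            -(Weight.size χ) ≤ (m : ℤ) * 2 ^ ((Nat.log 2 m + c₀) ^ c₀) := by
  intro c
  obtain ⟨c₀, hc₀⟩ := hS c
  refine ⟨c₀, fun m e hm he g hg hg0 hrep χ hγ => ?_⟩
  obtain ⟨ι, hι, hup⟩ := exists_finalSegment (n := m) (n' := m + e) (Nat.le_add_right m e)
  have hmem : rename ι g ∈ orbitClosure (powFormLex ℂ (m + e) m) :=
    mem_orbitClosure_powFormLex_of_hasPowTraceRepr (hasPowTraceRepr_rename hrep ι)
  exact hc₀ m e hm he ι hι hup χ
    (finrank_ne_zero_extend_of_rename_mem_orbitClosure hι hup hg hg0 (by omega) hmem χ hγ)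

/-- **`PowGenDegreeQP` ⇒ the same uniform bound** (through `sliceGen_of_powGenDegreeQP`): the route's
crux K2 already asserts quasi-polynomial generation of `A(Δ g)` for every qp-easy `m²`-variate
`m`-form `g`. [folklore] -/
theorem genQP_of_powGenDegreeQP_of_hasPowTraceRepr (hK2 : PowGenDegreeQP) :
    ∀ c : ℕ, ∃ c₀ : ℕ, ∀ m e : ℕ, 1 ≤ m → m + e ≤ 2 ^ ((Nat.log 2 m + c) ^ c) →
      ∀ g : MvPolynomial (MatIdx m) ℂ, g.IsHomogeneous m → g ≠ 0 → HasPowTraceRepr ℂ g m (m + e) →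
        ∀ χ : Weight (MatIdx m),
          Module.finrank ℂ (↥(highestWeightSpace (orbitCoordRep g m) χ) ⧸ Submodule.comap (highestWeightSpace (orbitCoordRep g m) χ).subtype (⨆ p : Weight (MatIdx m) × Weight (MatIdx m), ⨆ (_ : p.1 + p.2 = χ ∧ p.1 ≠ 0 ∧ p.2 ≠ 0), highestWeightSpace (orbitCoordRep g m) p.1 * highestWeightSpace (orbitCoordRep g m) p.2)) ≠ 0 →
            -(Weight.size χ) ≤ (m : ℤ) * 2 ^ ((Nat.log 2 m + c₀) ^ c₀) :=
  genQP_of_sliceGen_of_hasPowTraceRepr (sliceGen_of_powGenDegreeQP hK2)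

end EasyForms

end

end Summit.ValiantsHypothesis.ValiantsHypothesis.Theorems.GeneratorObstructions.SliceTransfer
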